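import Summits.CriticalPhenomena.PercolationContinuityZ3.Theorems.PercNearOneGluingNoHeavyLowerTailSunflowerLeafLeafTwoLevel
import Summits.CriticalPhenomena.PercolationContinuityZ3.Theorems.PercNearOneGluingNoHeavyLowerTailSunflowerKDecreasing
import HarnessLib

/-!
# `NoHeavyLowerTail` (crux stmt-CriticalPhenomena-4575), abstract sunflower cubic: THE TWO-LEVEL LEMMA A AT A LEAF
# (`TwoLevelLemmaA p (A ∪ [vz]) (A ∪ [vz] ∪ [z])` for a pendant coordinate `z` hung at `v`) FROM THE GRADED T-BERN INEQUALITY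

Support file (seat `prim-ineq-prove-1` gen 68; `--supports stmt-CriticalPhenomena-4575`).  No `sorry`, no named facts; one
definition (`GradedTBern`, conjecture-shaped, used only as a hypothesis).  Memo:
run/shared/lean/prim/prim-ineq-prove-1/FINDING-EDGE-prove1-g68.md §2–§3.

SETTING (`…SunflowerPendant`, `…SunflowerLeafLeafTwoLevel`).  `A` an up-set not depending on `z`, `v ≠ z`, `C := A ∪ {v,z open}`
(the pendant core) and `T := C ∪ {z open} = A ∪ {z open}`.  The two-level Lemma A `TwoLevelLemmaA p C T` (up-sets `L_j ⊇ C` pairwise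
meeting in `C`, `U_i ⊇ T` pairwise meeting in `T`, `L_j ∩ U_i ⊆ T` ⟹ `∏ μ(L_j)·∏ μ(U_i) ≤ μ(C)^(|Q|−1)·μ(T)^|P|`) is the pair
"(core, core with the leaf `z` looped)".  Conditioning on the block `{v, z}` exactly as in `Pendant.safe_union_pendant`:
a `Q`-petal has sections `u_j` (`v` absent), `vv_j` (`z` absent), `m_j` (both absent), a `P`-petal is everything when `z` is present
and has `z`-absent section of measure `x_i = (1−s)m'_i + s·v'_i`; the `v`-absent sections of the `L_j` form a petal system of
`delMinor v A`, the `z`-absent ones of `conMinor v A`, and the `z`-ABSENT SECTIONS OF ALL `|Q|+|P|` PETALS TOGETHER form one petal system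
of `A` (this joint budget is the only place where the two families interact).  Concentrating the `P`-petals into one virtual petal
(`KDecreasing.prod_affine_le`) leaves exactly the hypotheses of:
* `GradedTBern s b β` — the GRADED T-BERN inequality: for petals `(u_j, vv_j, m_j)` as in `TBern s b β 1` (budgets `∏u ≤ b^(n−1)`,
  `∏vv ≤ β^(n−1)`) whose block budget is TIGHTENED to `(∏ m̄_j)·x ≤ a₀^n` by a phantom block `x ∈ [a₀, 1]` (`a₀ = (1−s)b+sβ`,
  `m̄ = (1−s)m + s·vv`):  `(∏_j ℓ_j(t))·(t + (1−t)x) ≤ F^(n−1)·(t + (1−t)a₀)` for every `t ∈ [0,1]`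
  (`ℓ_j(t) = st + s(1−t)vv_j + (1−s)t·u_j + (1−s)(1−t)m_j`, `F = st + s(1−t)β + (1−s)b`).  At `x = a₀` it is the pendant lemma
  (`CappedPendant s t b β 1`), at `x = 1` it has the strength of the relative Lemma A; numerically exact (memo §3); OPEN.
* **`twoLevel_union_pendant`**: `A`, `delMinor v A`, `conMinor v A` safe at `p`, `μ(delMinor v A) > 0`, `GradedTBern (p v) b β`
  ⟹ `TwoLevelLemmaA p (A ∪ pairOpen v z) (A ∪ pairOpen v z ∪ {ω | z ∈ ω})`.
This is the "two-level budget" consumed by the edge decomposition of Lemma A for cycles (memo §4).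
-/

noncomputable section

namespace Summit.CriticalPhenomena.PercolationContinuityZ3.Theorems.SunflowerPartition

namespace SafeCalc

open MeasureTheory Finset
open Literature.Probability.LatticeModels Literature.Probability.Percolation

namespace LinkedCurrency

/-- **The graded T-BERN inequality `GradedTBern s b β` (statement).**  For every `n ≥ 1`, every phantom block `x ∈ [a₀, 1]`
(`a₀ = (1−s)b + sβ`), every `t ∈ [0,1]` and every family `(u_j, vv_j, m_j)_{j<n}` with `b ≤ m_j ≤ u_j ≤ 1`, `β ≤ vv_j ≤ 1`,
`m_j ≤ vv_j`, `∏u ≤ b^(n−1)`, `∏vv ≤ β^(n−1)` and the tightened block budget `(∏((1−s)m_j + s·vv_j))·x ≤ a₀^n`: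
`(∏_j (st + s(1−t)vv_j + (1−s)t·u_j + (1−s)(1−t)m_j))·(t + (1−t)x) ≤ (st + s(1−t)β + (1−s)b)^(n−1)·(t + (1−t)a₀)`.
[conjecture-shaped hypothesis, this work] -/
def GradedTBern (s b β : ℝ) : Prop :=
  ∀ (n : ℕ) (u vv m : Fin n → ℝ) (x t : ℝ), 0 < n → (1 - s) * b + s * β ≤ x → x ≤ 1 → 0 ≤ t → t ≤ 1 →
    (∀ j, b ≤ u j) → (∀ j, u j ≤ 1) → (∀ j, β ≤ vv j) → (∀ j, vv j ≤ 1) →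
    (∀ j, b ≤ m j) → (∀ j, m j ≤ u j) → (∀ j, m j ≤ vv j) →
    ∏ j, u j ≤ b ^ (n - 1) → ∏ j, vv j ≤ β ^ (n - 1) →
    (∏ j, ((1 - s) * m j + s * vv j)) * x ≤ ((1 - s) * b + s * β) ^ n →
    (∏ j, (s * t + s * (1 - t) * vv j + (1 - s) * t * u j + (1 - s) * (1 - t) * m j)) * (t + (1 - t) * x) ≤
      (s * t + s * (1 - t) * β + (1 - s) * b) ^ (n - 1) * (t + (1 - t) * ((1 - s) * b + s * β))

end LinkedCurrency

namespace Pendant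

open UnionEdge LinkedCurrency

variable {ι : Type*} [DecidableEq ι] (p : ι → unitInterval)

/-- Sections of `{ω | z ∈ ω}` along the block `{v, z}`: everything when `z` is present, nothing when `z` is missing. [this work] -/
theorem sect_pair_setOf_mem (v z : ι) (T : Finset ι) :
    sect ({v, z} : Finset ι) T {ω : Set ι | z ∈ ω} = (if z ∈ T then ∅ else Set.univ) := by
  ext ω
  simp only [sect, Set.mem_setOf_eq, Set.mem_union, Set.mem_sdiff, Finset.coe_sdiff, Finset.coe_insert, Finset.coe_singleton,
    Set.mem_insert_iff, Set.mem_singleton_iff, or_true, not_true_eq_false, and_false, false_or, true_and, Finset.mem_coe]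
  split_ifs with h <;> simp [h]

/-- The `z`-absent section (block `{z}`) of `{ω | z ∈ ω}` is empty. [this work] -/
theorem sect_z_setOf_mem (z : ι) : sect ({z} : Finset ι) {z} {ω : Set ι | z ∈ ω} = ∅ := by
  ext ω
  simp [sect]

set_option maxHeartbeats 800000 in
/-- **THE TWO-LEVEL LEMMA A AT A LEAF, FROM THE GRADED T-BERN INEQUALITY (fixed `p`).**  Let `A` be an up-set not depending on
`z`, `v ≠ z`, with `A`, `delMinor v A`, `conMinor v A` safe at `p` and `μ(delMinor v A) > 0`; assume `GradedTBern (p v) b β` with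
`b = μ(delMinor v A)`, `β = μ(conMinor v A)`.  Then `TwoLevelLemmaA p (A ∪ {v,z open}) (A ∪ {v,z open} ∪ {z open})`. [this work] -/
theorem twoLevel_union_pendant [Fintype ι] {v z : ι} (hne : v ≠ z) {A : Set (Set ι)}
    (hd : DeterminedBy A (↑({z} : Finset ι) : Set ι)ᶜ) (hu : IsUpperSet A) (hA : Safe p A)
    (hA0 : Safe p (delMinor v A)) (hA1 : Safe p (conMinor v A)) (hpos : 0 < (prodBernoulli p).real (delMinor v A))
    (hG : GradedTBern (p v : ℝ) ((prodBernoulli p).real (delMinor v A)) ((prodBernoulli p).real (conMinor v A))) :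
    TwoLevelLemmaA p (A ∪ pairOpen v z) (A ∪ pairOpen v z ∪ {ω | z ∈ ω}) := by
  classical
  intro n L U Q P hQ hdisj hLup hLC hUup hUT hLL hUU hLU
  set bk : Finset ι := {v, z} with hbk
  set B : Set (Set ι) := A ∪ pairOpen v z with hB
  set Z : Set (Set ι) := {ω | z ∈ ω} with hZ
  set T : Set (Set ι) := A ∪ pairOpen v z ∪ Z with hTdef
  have hBup : IsUpperSet B := hu.union (isUpperSet_pairOpen v z)
  have hZup : IsUpperSet Z := fun _ _ hle h => hle h
  have hTup : IsUpperSet T := hBup.union hZup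
  have hBT : B ⊆ T := Set.subset_union_left
  -- sections of the cores
  obtain ⟨e0, ez, ev, evz⟩ := sect_pairOpen hne
  obtain ⟨avz, av, az, a0⟩ := sect_pair_eq_minor hd
  have hzv : z ≠ v := hne.symm
  have hBz : sect bk {z} B = conMinor v A := by rw [hB, sect_union, az, ez, Set.union_empty]
  have hBv : sect bk {v} B = delMinor v A := by rw [hB, sect_union, av, ev, Set.union_empty]
  have hBvz : sect bk {v, z} B = delMinor v A := by rw [hB, sect_union, avz, evz, Set.union_empty]
  have hB0 : sect bk ∅ B = Set.univ := by rw [hB, sect_union, e0, Set.union_univ]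
  have hZz : sect bk {z} Z = ∅ := by rw [hZ, sect_pair_setOf_mem]; simp
  have hZvz : sect bk {v, z} Z = ∅ := by rw [hZ, sect_pair_setOf_mem]; simp
  have hZv : sect bk {v} Z = Set.univ := by rw [hZ, sect_pair_setOf_mem]; simp [hzv]
  have hTz : sect bk {z} T = conMinor v A := by rw [hTdef, sect_union, hBz, hZz, Set.union_empty]
  have hTvz : sect bk {v, z} T = delMinor v A := by rw [hTdef, sect_union, hBvz, hZvz, Set.union_empty]
  have hTv : sect bk {v} T = Set.univ := by rw [hTdef, sect_union, hZv, Set.union_univ]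
  have hT0 : sect bk ∅ T = Set.univ := by rw [hTdef, sect_union, hB0, Set.univ_union]
  -- the `z`-absent sections (block `{z}`) of `B` and `T` are `A`
  have hBzz : sect ({z} : Finset ι) {z} B = A := by
    rw [hB, sect_union, sect_eq_self_of_determinedBy_compl {z} {z} hd, sect_z_pairOpen, Set.union_empty]
  have hTzz : sect ({z} : Finset ι) {z} T = A := by
    rw [hTdef, sect_union, hBzz, hZ, sect_z_setOf_mem, Set.union_empty]
  -- coins and floors
  set s : ℝ := ((p v : unitInterval) : ℝ) with hs
  set t : ℝ := ((p z : unitInterval) : ℝ) with ht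
  set b : ℝ := (prodBernoulli p).real (delMinor v A) with hbdef
  set β : ℝ := (prodBernoulli p).real (conMinor v A) with hβdef
  set α : ℝ := (1 - s) * b + s * β with hαdef
  have hs0 : 0 ≤ s := (p v).2.1
  have hs1 : s ≤ 1 := (p v).2.2
  have ht0 : 0 ≤ t := (p z).2.1
  have ht1 : t ≤ 1 := (p z).2.2
  have hs' : 0 ≤ 1 - s := sub_nonneg.2 hs1
  have ht' : 0 ≤ 1 - t := sub_nonneg.2 ht1
  have hb0 : 0 < b := hpos
  have hbβ : b ≤ β := measureReal_mono ((delMinor_subset v hu).trans (subset_conMinor v hu))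
  have hβ1 : β ≤ 1 := measureReal_le_one
  have hα0 : 0 < α := by rw [hαdef]; nlinarith
  have hα1 : α ≤ 1 := by rw [hαdef]; nlinarith [hb0.le.trans hbβ]
  -- measures of the cores
  have hAval : (prodBernoulli p).real A = α := by
    rw [real_eq_BEx p bk A, BEx_pair p hne, a0, az, av, avz, hαdef]; ring
  have hBval : (prodBernoulli p).real B = s * t + s * (1 - t) * β + (1 - s) * b := by
    rw [real_eq_BEx p bk B, BEx_pair p hne, hB0, hBz, hBv, hBvz, probReal_univ]; ring
  have hTval : (prodBernoulli p).real T = t + (1 - t) * α := by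
    rw [real_eq_BEx p bk T, BEx_pair p hne, hT0, hTz, hTv, hTvz, probReal_univ, hαdef]; ring
  rw [hBval, hTval]
  -- the case `P = ∅`: safety of the pendant core
  rcases P.eq_empty_or_nonempty with hPe | hPne
  · rw [hPe, prod_empty, mul_one, card_empty, pow_zero, mul_one]
    have hBsafe : Safe p B := safe_union_pendant p hne hd hu hA hA0 hA1
    have h1 := hBsafe.prod_le (κ := Q) (V := fun j : Q => L j) (fun j => hLup j j.2)
      (fun i j hij => hLL i i.2 j j.2 fun h => hij (Subtype.ext h))
    rw [Fintype.card_coe, hBval] at h1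
    rw [← prod_coe_sort Q]; exact h1
  -- section measures of the `Q`-petals
  set uu : Fin n → ℝ := fun j => (prodBernoulli p).real (sect bk {v} (L j)) with huu
  set vv : Fin n → ℝ := fun j => (prodBernoulli p).real (sect bk {z} (L j)) with hvvd
  set mm : Fin n → ℝ := fun j => (prodBernoulli p).real (sect bk {v, z} (L j)) with hmmd
  have hLle : ∀ j ∈ Q, (prodBernoulli p).real (L j) ≤
      s * t + s * (1 - t) * vv j + (1 - s) * t * uu j + (1 - s) * (1 - t) * mm j := by
    intro j _
    rw [real_eq_BEx p bk (L j), BEx_pair p hne]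
    have h1 : (prodBernoulli p).real (sect bk ∅ (L j)) ≤ 1 := measureReal_le_one
    have := mul_le_mul_of_nonneg_left h1 (mul_nonneg hs0 ht0)
    simp only [huu, hvvd, hmmd]
    linarith
  have hub : ∀ j ∈ Q, b ≤ uu j := fun j hj => by
    have h := sect_mono bk {v} (hLC j hj); rw [hBv] at h; exact measureReal_mono h
  have hvβ : ∀ j ∈ Q, β ≤ vv j := fun j hj => by
    have h := sect_mono bk {z} (hLC j hj); rw [hBz] at h; exact measureReal_mono h
  have hmb : ∀ j ∈ Q, b ≤ mm j := fun j hj => by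
    have h := sect_mono bk {v, z} (hLC j hj); rw [hBvz] at h; exact measureReal_mono h
  have hu1 : ∀ j, uu j ≤ 1 := fun j => measureReal_le_one
  have hv1 : ∀ j, vv j ≤ 1 := fun j => measureReal_le_one
  have hmu : ∀ j ∈ Q, mm j ≤ uu j := fun j hj =>
    measureReal_mono (sect_anti bk (show ({v} : Finset ι) ⊆ {v, z} by simp) (hLup j hj))
  have hmv : ∀ j ∈ Q, mm j ≤ vv j := fun j hj =>
    measureReal_mono (sect_anti bk (show ({z} : Finset ι) ⊆ {v, z} by simp) (hLup j hj))
  -- section measures of the `P`-petals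
  set vp : Fin n → ℝ := fun i => (prodBernoulli p).real (sect bk {z} (U i)) with hvpd
  set mp : Fin n → ℝ := fun i => (prodBernoulli p).real (sect bk {v, z} (U i)) with hmpd
  set xx : Fin n → ℝ := fun i => (1 - s) * mp i + s * vp i with hxxd
  have hUle : ∀ i ∈ P, (prodBernoulli p).real (U i) ≤ t + (1 - t) * xx i := by
    intro i _
    rw [real_eq_BEx p bk (U i), BEx_pair p hne]
    have h1 : (prodBernoulli p).real (sect bk ∅ (U i)) ≤ 1 := measureReal_le_one
    have h2 : (prodBernoulli p).real (sect bk {v} (U i)) ≤ 1 := measureReal_le_one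
    have k1 := mul_le_mul_of_nonneg_left h1 (mul_nonneg hs0 ht0)
    have k2 := mul_le_mul_of_nonneg_left h2 (mul_nonneg hs' ht0)
    simp only [hxxd, hvpd, hmpd]
    nlinarith
  have hvpβ : ∀ i ∈ P, β ≤ vp i := fun i hi => by
    have h := sect_mono bk {z} (hUT i hi); rw [hTz] at h; exact measureReal_mono h
  have hmpb : ∀ i ∈ P, b ≤ mp i := fun i hi => by
    have h := sect_mono bk {v, z} (hUT i hi); rw [hTvz] at h; exact measureReal_mono h
  have hxxα : ∀ i ∈ P, α ≤ xx i := fun i hi => by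
    simp only [hxxd, hαdef]; nlinarith [hvpβ i hi, hmpb i hi]
  have hxx0 : ∀ i ∈ P, 0 < xx i := fun i hi => hα0.trans_le (hxxα i hi)
  -- budgets: `v`-absent sections of the `L`'s (delMinor), `z`-absent sections (conMinor)
  have hpu : ∏ j ∈ Q, uu j ≤ b ^ (Q.card - 1) := by
    have hcap : ∀ i j : Q, i ≠ j → sect bk {v} (L i) ∩ sect bk {v} (L j) ⊆ delMinor v A := by
      intro i j hij; rw [← sect_inter, ← hBv]
      exact sect_mono bk {v} (hLL i i.2 j j.2 fun h => hij (Subtype.ext h))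
    have h1 := hA0.prod_le (κ := Q) (V := fun j : Q => sect bk {v} (L j)) (fun j => isUpperSet_sect bk _ (hLup j j.2)) hcap
    rw [Fintype.card_coe] at h1
    rw [← prod_coe_sort Q]; exact h1
  have hpv : ∏ j ∈ Q, vv j ≤ β ^ (Q.card - 1) := by
    have hcap : ∀ i j : Q, i ≠ j → sect bk {z} (L i) ∩ sect bk {z} (L j) ⊆ conMinor v A := by
      intro i j hij; rw [← sect_inter, ← hBz]
      exact sect_mono bk {z} (hLL i i.2 j j.2 fun h => hij (Subtype.ext h))
    have h1 := hA1.prod_le (κ := Q) (V := fun j : Q => sect bk {z} (L j)) (fun j => isUpperSet_sect bk _ (hLup j j.2)) hcap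
    rw [Fintype.card_coe] at h1
    rw [← prod_coe_sort Q]; exact h1
  -- the joint budget: the `z`-absent sections of ALL petals form a petal system of `A`
  set W : Fin n → Set (Set ι) := fun k => if k ∈ Q then L k else U k with hW
  have hWup : ∀ k ∈ Q ∪ P, IsUpperSet (W k) := by
    intro k hk
    simp only [hW]
    split_ifs with hkQ
    · exact hLup k hkQ
    · exact hUup k ((mem_union.1 hk).resolve_left hkQ)
  have hWcap : ∀ k ∈ Q ∪ P, ∀ l ∈ Q ∪ P, k ≠ l → W k ∩ W l ⊆ T := by
    intro k hk l hl hkl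
    simp only [hW]
    have hkP : k ∉ Q → k ∈ P := fun h => (mem_union.1 hk).resolve_left h
    have hlP : l ∉ Q → l ∈ P := fun h => (mem_union.1 hl).resolve_left h
    split_ifs with hkQ hlQ hlQ
    · exact (hLL k hkQ l hlQ hkl).trans hBT
    · exact hLU k hkQ l (hlP hlQ)
    · rw [Set.inter_comm]; exact hLU l hlQ k (hkP hkQ)
    · exact hUU k (hkP hkQ) l (hlP hlQ) hkl
  set G : Fin n → Set (Set ι) := fun k => sect ({z} : Finset ι) {z} (W k) with hGd
  have hdisjvz : Disjoint ({v} : Finset ι) {z} := by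
    rw [Finset.disjoint_singleton_left, Finset.mem_singleton]; exact hne
  have hGval : ∀ k, (prodBernoulli p).real (G k) =
      (1 - s) * (prodBernoulli p).real (sect bk {v, z} (W k)) + s * (prodBernoulli p).real (sect bk {z} (W k)) := by
    intro k
    rw [real_eq_BEx p {v} (G k), BEx_singleton]
    simp only [hGd]
    rw [sect_sect hdisjvz (Finset.empty_subset _) subset_rfl, sect_sect hdisjvz subset_rfl subset_rfl, Finset.empty_union]
    have e1 : ({v} : Finset ι) ∪ {z} = bk := by rw [hbk, Finset.insert_eq]
    rw [e1]
    ring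
  have hGQ : ∀ j ∈ Q, (prodBernoulli p).real (G j) = (1 - s) * mm j + s * vv j := by
    intro j hj; rw [hGval j]; simp only [hW, if_pos hj, hmmd, hvvd]
  have hGP : ∀ i ∈ P, (prodBernoulli p).real (G i) = xx i := by
    intro i hi
    have hiQ : i ∉ Q := fun h => disjoint_left.1 hdisj h hi
    rw [hGval i]; simp only [hW, if_neg hiQ, hxxd, hmpd, hvpd]
  have hGsys : ∀ S : Finset (Fin n), S ⊆ Q ∪ P → ∏ k ∈ S, (prodBernoulli p).real (G k) ≤ α ^ (S.card - 1) := by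
    intro S hS
    have hcap : ∀ i j : S, i ≠ j → G i ∩ G j ⊆ A := by
      intro i j hij
      simp only [hGd]
      rw [← sect_inter, ← hTzz]
      exact sect_mono {z} {z} (hWcap i (hS i.2) j (hS j.2) fun h => hij (Subtype.ext h))
    have h1 := hA.prod_le (κ := S) (V := fun k : S => G k) (fun k => isUpperSet_sect {z} {z} (hWup k (hS k.2))) hcap
    rw [Fintype.card_coe, hAval] at h1
    rw [← prod_coe_sort S]; exact h1
  have hpg : (∏ j ∈ Q, ((1 - s) * mm j + s * vv j)) * ∏ i ∈ P, xx i ≤ α ^ (Q.card + P.card - 1) := by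
    have h1 := hGsys (Q ∪ P) subset_rfl
    rw [prod_union hdisj, card_union_of_disjoint hdisj, prod_congr rfl hGQ, prod_congr rfl hGP] at h1
    exact h1
  have hpx : ∏ i ∈ P, xx i ≤ α ^ (P.card - 1) := by
    have h1 := hGsys P subset_union_right
    rw [prod_congr rfl hGP] at h1
    exact h1
  -- concentrate the `P`-petals into one phantom block `x* = ∏ xx / α^(|P|−1)`
  have hP1 : 1 ≤ P.card := card_pos.2 hPne
  set xP : ℝ := ∏ i ∈ P, xx i with hxPd
  set xs : ℝ := xP / α ^ (P.card - 1) with hxsd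
  have hαP : 0 < α ^ (P.card - 1) := pow_pos hα0 _
  have hxP0 : 0 < xP := prod_pos fun i hi => hxx0 i hi
  have hxs1 : xs ≤ 1 := by rw [hxsd, div_le_one hαP]; exact hpx
  have hxsα : α ≤ xs := by
    rw [hxsd, le_div_iff₀ hαP]
    have hPc : P.card = P.card - 1 + 1 := (Nat.sub_add_cancel hP1).symm
    calc α * α ^ (P.card - 1) = α ^ P.card := by rw [mul_comm, ← pow_succ, ← hPc]
      _ = ∏ _i ∈ P, α := by rw [prod_const]
      _ ≤ xP := prod_le_prod (fun _ _ => hα0.le) fun i hi => hxxα i hi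
  have hconc : ∏ i ∈ P, (t + (1 - t) * xx i) ≤ (t + (1 - t) * xs) * (t + (1 - t) * α) ^ (P.card - 1) := by
    have hz : ∀ i ∈ P, 1 ≤ xx i / α := fun i hi => (one_le_div hα0).2 (hxxα i hi)
    have h1 := KDecreasing.prod_affine_le P ht0 (mul_nonneg ht' hα0.le) (fun i => xx i / α) hz hPne
    have e1 : ∀ i ∈ P, t + (1 - t) * α * (xx i / α) = t + (1 - t) * xx i := fun i _ => by field_simp
    have e2 : (1 - t) * α * ∏ i ∈ P, xx i / α = (1 - t) * xs := by
      rw [prod_div_distrib, prod_const, hxsd, hxPd]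
      have hPc : P.card = P.card - 1 + 1 := (Nat.sub_add_cancel hP1).symm
      conv_lhs => rw [hPc, pow_succ]
      field_simp
    rw [prod_congr rfl e1, e2] at h1
    exact h1
  -- transport the `Q`-family to `Fin |Q|` and apply the graded T-BERN inequality
  set q : ℕ := Q.card with hqd
  have hq : 0 < q := card_pos.2 hQ
  let eQ : Q ≃ Fin q := Fintype.equivOfCardEq (by rw [Fintype.card_coe, Fintype.card_fin])
  set u' : Fin q → ℝ := fun k => uu (eQ.symm k) with hu'd
  set v' : Fin q → ℝ := fun k => vv (eQ.symm k) with hv'd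
  set m' : Fin q → ℝ := fun k => mm (eQ.symm k) with hm'd
  have htr : ∀ f : Fin n → ℝ, ∏ k : Fin q, f (eQ.symm k) = ∏ j ∈ Q, f j := by
    intro f
    rw [← prod_coe_sort Q]
    exact Fintype.prod_equiv eQ.symm (fun k => f (eQ.symm k)) (fun j => f j) fun k => rfl
  have hpg' : (∏ k : Fin q, ((1 - s) * m' k + s * v' k)) * xs ≤ α ^ q := by
    rw [show (∏ k : Fin q, ((1 - s) * m' k + s * v' k)) = ∏ j ∈ Q, ((1 - s) * mm j + s * vv j) from
      htr fun j => (1 - s) * mm j + s * vv j]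
    rw [hxsd, mul_div_assoc', div_le_iff₀ hαP, ← pow_add]
    have e : q + (P.card - 1) = Q.card + P.card - 1 := by rw [hqd]; omega
    rw [e]; exact hpg
  have key := hG q u' v' m' xs t hq hxsα hxs1 ht0 ht1 (fun k => hub _ (eQ.symm k).2) (fun k => hu1 _)
    (fun k => hvβ _ (eQ.symm k).2) (fun k => hv1 _) (fun k => hmb _ (eQ.symm k).2) (fun k => hmu _ (eQ.symm k).2)
    (fun k => hmv _ (eQ.symm k).2) (by rw [htr uu]; exact hpu) (by rw [htr vv]; exact hpv) hpg'
  rw [show (∏ k : Fin q, (s * t + s * (1 - t) * v' k + (1 - s) * t * u' k + (1 - s) * (1 - t) * m' k)) =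
      ∏ j ∈ Q, (s * t + s * (1 - t) * vv j + (1 - s) * t * uu j + (1 - s) * (1 - t) * mm j) from
    htr fun j => s * t + s * (1 - t) * vv j + (1 - s) * t * uu j + (1 - s) * (1 - t) * mm j] at key
  -- assemble
  have hF0 : 0 ≤ s * t + s * (1 - t) * β + (1 - s) * b :=
    add_nonneg (add_nonneg (mul_nonneg hs0 ht0) (mul_nonneg (mul_nonneg hs0 ht') (hb0.le.trans hbβ))) (mul_nonneg hs' hb0.le)
  have hTv0 : 0 ≤ t + (1 - t) * α := add_nonneg ht0 (mul_nonneg ht' hα0.le)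
  have hℓ0 : ∀ j ∈ Q, 0 ≤ s * t + s * (1 - t) * vv j + (1 - s) * t * uu j + (1 - s) * (1 - t) * mm j := fun j _ =>
    add_nonneg (add_nonneg (add_nonneg (mul_nonneg hs0 ht0) (mul_nonneg (mul_nonneg hs0 ht') measureReal_nonneg))
      (mul_nonneg (mul_nonneg hs' ht0) measureReal_nonneg)) (mul_nonneg (mul_nonneg hs' ht') measureReal_nonneg)
  have hPQ0 : 0 ≤ ∏ j ∈ Q, (s * t + s * (1 - t) * vv j + (1 - s) * t * uu j + (1 - s) * (1 - t) * mm j) :=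
    prod_nonneg hℓ0
  calc (∏ j ∈ Q, (prodBernoulli p).real (L j)) * ∏ i ∈ P, (prodBernoulli p).real (U i)
      ≤ (∏ j ∈ Q, (s * t + s * (1 - t) * vv j + (1 - s) * t * uu j + (1 - s) * (1 - t) * mm j)) *
          ∏ i ∈ P, (t + (1 - t) * xx i) :=
        mul_le_mul (prod_le_prod (fun j _ => measureReal_nonneg) hLle) (prod_le_prod (fun i _ => measureReal_nonneg) hUle)
          (prod_nonneg fun i _ => measureReal_nonneg) hPQ0
    _ ≤ (∏ j ∈ Q, (s * t + s * (1 - t) * vv j + (1 - s) * t * uu j + (1 - s) * (1 - t) * mm j)) *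
          ((t + (1 - t) * xs) * (t + (1 - t) * α) ^ (P.card - 1)) := mul_le_mul_of_nonneg_left hconc hPQ0
    _ = (∏ j ∈ Q, (s * t + s * (1 - t) * vv j + (1 - s) * t * uu j + (1 - s) * (1 - t) * mm j)) *
          (t + (1 - t) * xs) * (t + (1 - t) * α) ^ (P.card - 1) := by ring
    _ ≤ (s * t + s * (1 - t) * β + (1 - s) * b) ^ (q - 1) * (t + (1 - t) * α) * (t + (1 - t) * α) ^ (P.card - 1) :=
        mul_le_mul_of_nonneg_right key (pow_nonneg hTv0 _)
    _ = (s * t + s * (1 - t) * β + (1 - s) * b) ^ (Q.card - 1) * (t + (1 - t) * α) ^ P.card := by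
        have hPc : P.card = P.card - 1 + 1 := (Nat.sub_add_cancel hP1).symm
        rw [hqd]
        conv_rhs => rw [hPc, pow_succ]
        ring

/-- **The two-level Lemma A at a leaf from A-safety of `A`** (+ positivity and `GradedTBern`). [this work] -/
theorem twoLevel_union_pendant_aSafe [Fintype ι] {v z : ι} (hne : v ≠ z) {A : Set (Set ι)}
    (hd : DeterminedBy A (↑({z} : Finset ι) : Set ι)ᶜ) (hu : IsUpperSet A) (hA : ∀ q, Safe q A)
    (hpos : 0 < (prodBernoulli p).real (delMinor v A))
    (hG : GradedTBern (p v : ℝ) ((prodBernoulli p).real (delMinor v A)) ((prodBernoulli p).real (conMinor v A))) :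
    TwoLevelLemmaA p (A ∪ pairOpen v z) (A ∪ pairOpen v z ∪ {ω | z ∈ ω}) :=
  twoLevel_union_pendant p hne hd hu (hA p) (aSafe_delMinor hu hA v p) (aSafe_conMinor hu hA v p) hpos hG

end Pendant

end SafeCalc

end Summit.CriticalPhenomena.PercolationContinuityZ3.Theorems.SunflowerPartition
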